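import Mathlib
import Summits.Ventures.PercRepro2.OStarModel

/-!
# The o-star certificate, typing `t₁ = 2` (blind cell PercRepro2, mine-2 g39, 2026-08-28;
`proofs/MINE2-GLUE.md` §2, row M2-83)

`cert2`: the gadget sum `C 2 t₂ t_b P₁ P₂ P₃` of `OStarModel.lean` is nonnegative for every
typing `t₂, t_b ∈ {0, 1, 2, 3}` of the edges `o–a₂, o–b` (the edge `o–a₁` of type `2`) and every
sorted triple of `Q`-patterns (set partitions of `a₁, a₂, a₃, b` not joining the roots), decided
in the kernel.  Own code; standard axioms.
-/

namespace Summit.Ventures.PercRepro2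

namespace CovForm

namespace OStar

/-- **The o-star certificate at `t₁ = 2`**: `0 ≤ C 2 t₂ t_b` on every sorted triple of
`Q`-patterns, every `t₂, t_b ≤ 3`. -/
theorem cert2 : ∀ t₂ tb : Fin 4, ∀ b₁ b₂ b₃ b₄ b₅ b₆ : Bool,
    validQ (b₁, b₂, b₃, b₄, b₅, b₆) = true →
    ∀ c₁ c₂ c₃ c₄ c₅ c₆ : Bool, validQ (c₁, c₂, c₃, c₄, c₅, c₆) = true →
    key (b₁, b₂, b₃, b₄, b₅, b₆) ≤ key (c₁, c₂, c₃, c₄, c₅, c₆) →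
    ∀ d₁ d₂ d₃ d₄ d₅ d₆ : Bool, validQ (d₁, d₂, d₃, d₄, d₅, d₆) = true →
    key (c₁, c₂, c₃, c₄, c₅, c₆) ≤ key (d₁, d₂, d₃, d₄, d₅, d₆) →
    0 ≤ C 2 t₂.val tb.val (b₁, b₂, b₃, b₄, b₅, b₆) (c₁, c₂, c₃, c₄, c₅, c₆)
      (d₁, d₂, d₃, d₄, d₅, d₆) := by
  decide +kernel

end OStar

end CovForm

end Summit.Ventures.PercRepro2
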